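import Literature.MathematicalPhysics.QuantumLattice.DWaveSourceNNNHoppingFlatTwist
import Literature.MathematicalPhysics.QuantumLattice.DWaveSourceNNNHoppingEnergyDensityExists
import Literature.MathematicalPhysics.QuantumLattice.HubbardNNNHoppingInteractionTorus
import Literature.MathematicalPhysics.QuantumLattice.PhaseGaugeLocality
import Literature.MathematicalPhysics.QuantumLattice.InfVolFermionStateGaugeAction
import HarnessLib

/-!
# The flat-twisted pair-sourced `t–t'` torus is the periodisation of ONE local density;
# thermodynamic limit of the sourced-helicity energy density (row T8)

Topic `Literature/MathematicalPhysics/QuantumLattice` (namespace = path; family `hubbard`). Hubbard cuprate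
cell (`hubbard-cq`), card `sourced-helicity-chord` (row T8): the TL-EXISTENCE item of hubbard-cq-p5's
SUCCESSOR PLAN (steps 1–4), built on p5's bricks `PhaseGaugeRelabel.lean` and the locality bricks
`PhaseGaugeLocality.lean`. Objects: the T8 Hamiltonian `dWaveSourceTorusTT'Twist L t' U μ h n`
(`DWaveSourceNNNHoppingFlatTwist.lean`: flat twist `χ_L(n·e)` on every hop, untwisted `d`-wave source).

* `windowTwistPhase κ` (`y ↦ κ₀^{y₀}κ₁^{y₁}` on a window), `boostPhase2_proj` (the global boost `χ_L(n·x)`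
  restricted to the window IS the window phase when `χ_L(n_i) = κ_i`), `boostPhase2_sub` (character).
* `twistedHoppingObs t' U κ = W_κ E_Φ W_κᴴ` — the hopping–interaction density of the `t–t'–U` model
  conjugated by the window twist (constant bond phases `κ^e`), Hermitian; `E_Φ` has gauge charge `0`.
* **`sum_relabel_translate_twistedHoppingObs`** — `Σ_v T_v Γ(W_κ E_Φ W_κᴴ) T_v⁻¹ = hubbardTorusTT'Twist L t' U n`
  for `L ≥ 3`, `χ_L(n_i) = κ_i`: the embedded window phase and the global boost agree on the window
  (`fermionEmbed_phaseGauge` + `phaseGauge_conj_eq_of_eqOn`); translating the boost costs a constant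
  phase, invisible to the gauge-invariant `Γ(E_Φ)`; the untwisted periodisation identity and the pure-gauge
  identity `conj_hubbardTorusTT'Twist` finish.
* `dWaveSourceEnergyObsTT'Twist t' U μ h κ = E^src + Γ(incl)(W_κ E_Φ W_κᴴ − E_Φ) ∈ 𝔄_W` and
  **`sum_relabel_translate_dWaveSourceEnergyObsTT'Twist`**: its translates sum to
  `dWaveSourceTorusTT'Twist L t' U μ h n` (trivial holonomy).
* `dWaveSourceTorusTT'TwistU1 L t' U μ h κ` — the periodisation on EVERY side (uniform `U(1)` twist `κ`
  per direction = flat connection of holonomy `κ_i^L`), `…_eq_sum`, `…_eq_twist`;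
  **`exists_tendsto_groundEnergy_dWaveSourceTorusTT'TwistU1_div_sq`** — ITS GROUND-STATE ENERGY DENSITY
  CONVERGES along all sides, to `min_{ω TI} Re ω(E^src_κ)` (model-free `exists_tendsto_groundEnergy_div_pow`);
  `toCircle_mul_eq` + **`dWaveSourceTorusTT'TwistU1_eq_twist_rational`** — for a rational twist
  `κ_i = χ_N(a_i)` the T8 objects on the sides `L = Nk ≥ L₀` ARE the uniformly twisted tori (twist
  `n = a·k`), so the T8 energy densities `E₀(dWaveSourceTorusTT'Twist (Nk) … (a·k))/(Nk)²` converge along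
  `k → ∞` to the same limit (compose the all-sides limit with `k ↦ Nk`).

HONEST SCOPE: definitions + periodisation bookkeeping + an existence-of-limit theorem for a W1-type sourced
word; no number, nothing about superconductivity; the value of the limit is not computed; sides with
non-trivial holonomy carry a seam and are NOT the T8 object (only the sides `L ∈ Nℕ` are identified).
Everything PROVED; no named fact; no `sorry`.

## References
* H. Watanabe, J. Stat. Phys. 177 (2019) 717, §2.2.1 (twists, pure gauges). [cite: Watanabe2019, §2.2.1]
* O. Bratteli, D. W. Robinson, *Operator Algebras and Quantum Statistical Mechanics 2* (1997), §5.2.2, §6.2.4.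
  [cite: BratteliRobinsonII1997, §6.2.4]
* O. Bratteli, A. Kishimoto, D. W. Robinson, Commun. Math. Phys. 64 (1978) 41, Thm. 2 (mean energy of
  periodic boundary conditions). [cite: BratteliKishimotoRobinson1978, Thm. 2]
* T. Koma, H. Tasaki, J. Stat. Phys. 76 (1994) 745, §1 (pair source). [cite: KomaTasaki1994, §1]
-/

noncomputable section

namespace Literature.MathematicalPhysics.QuantumLattice

open _root_.Matrix Finset Literature.MathematicalPhysics.QuantumFieldTheory Literature.Probability.LatticeModels
  HubbardWave0
open scoped ComplexConjugate

/-! ### The window twist phase and the boost -/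

/-- **The window twist phase** of a uniform `U(1)` twist `κ = (κ₀, κ₁)` per lattice direction:
`y ↦ κ₀^{y₀} κ₁^{y₁}` on the sites of a finite window `W ⊆ ℤ²` (the restriction to the window of the
two-dimensional boost `x ↦ e^{iq·x/2}`, `κ_i = e^{iq_i/2}`). [cite: Watanabe2019, §2.2.1] -/
def windowTwistPhase {W : Finset (Site 2)} (κ : Fin 2 → Circle) (y : PolySite W) : Circle :=
  ∏ i : Fin 2, κ i ^ ((ofLex y.1) i)

/-- **The boost restricted to the window is the window twist phase** when the torus holonomy matches:
if `χ_L(n_i) = κ_i` then `χ(n · (y mod L)) = κ₀^{y₀} κ₁^{y₁}` for every `y ∈ ℤ²`.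
[cite: Watanabe2019, §2.2.1] -/
theorem boostPhase2_proj (L : ℕ) [NeZero L] (n : Fin 2 → ZMod L) (κ : Fin 2 → Circle)
    (hκ : ∀ i, ZMod.toCircle (n i) = κ i) (y : Site 2) :
    boostPhase2 L n (Torus.proj L y) = ∏ i : Fin 2, κ i ^ (y i) := by
  rw [boostPhase2, Fin.prod_univ_two, ← hκ 0, ← hκ 1, Torus.proj_apply, Torus.proj_apply,
    ← AddChar.map_zsmul_eq_zpow, ← AddChar.map_zsmul_eq_zpow, ← AddChar.map_add_eq_mul, zsmul_eq_mul,
    zsmul_eq_mul, mul_comm (n 0), mul_comm (n 1)]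

/-- The boost is a character: `χ(n·(x − v)) = χ(n·x) · χ(n·v)⁻¹`. [cite: Watanabe2019, §2.2.1] -/
theorem boostPhase2_sub (L : ℕ) [NeZero L] (n : Fin 2 → ZMod L) (x v : TorusSite 2 L) :
    boostPhase2 L n (x - v) = boostPhase2 L n x * (boostPhase2 L n v)⁻¹ := by
  rw [boostPhase2, boostPhase2, boostPhase2, ← AddChar.map_neg_eq_inv, ← AddChar.map_add_eq_mul]
  congr 1
  simp only [Pi.sub_apply]
  ring


/-! ### The twisted hopping density and its periodisation -/

/-- **The twisted hopping–interaction density at the origin**: the mean-energy observable `E_Φ` of the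
`t–t'–U` interaction (`t = 1`) conjugated by the window twist, `W_κ E_Φ W_κᴴ` — its hopping monomials
`c†_{x+e,σ} c_{x,σ}` pick up the constant bond phase `κ^e = ∏_i κ_i^{e_i}`, the `U n↑n↓` terms are
unchanged. [cite: Watanabe2019, §2.2.1] -/
def twistedHoppingObs (t' U : ℝ) (κ : Fin 2 → Circle) : FermionOp (thicken ({0} : Finset (Site 2)) 1) :=
  phaseGauge (windowTwistPhase κ) * (hubbardTTPrimeFermionInteraction 1 t' U).meanEnergyObs 1 *
    (phaseGauge (windowTwistPhase κ))ᴴ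

/-- The twisted hopping density is Hermitian. [cite: Watanabe2019, §2.2.1] -/
theorem twistedHoppingObs_isHermitian (t' U : ℝ) (κ : Fin 2 → Circle) : (twistedHoppingObs t' U κ).IsHermitian := by
  unfold twistedHoppingObs
  have hE := FermionInteraction.meanEnergyObs_isHermitian (hubbardTTPrimeFermionInteraction_isHermitian 1 t' U) 1
  exact Matrix.isHermitian_mul_mul_conjTranspose _ hE

/-- The mean-energy observable of the `t–t'–U` interaction is gauge invariant (charge `0`).
[cite: BratteliRobinsonII1997, §5.2.2] -/
theorem hasGaugeCharge_zero_meanEnergyObs_hubbardTTPrime (t t' U : ℝ) :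
    HasGaugeCharge 0 ((hubbardTTPrimeFermionInteraction t t' U).meanEnergyObs 1) :=
  hasGaugeCharge_zero_iff.2 fun θ =>
    FermionInteraction.gaugeAut_meanEnergyObs (hubbardTTPrimeFermionInteraction_isGaugeInvariant t t' U) 1 θ

/-- **THE PERIODISATION OF THE TWISTED HOPPING DENSITY IS THE FLAT-TWISTED `t–t'` TORUS** (trivial
holonomy): for `L ≥ 3` and a twist `n ∈ (ℤ/L)²` with `χ_L(n_i) = κ_i`,
`Σ_{v ∈ (ℤ/L)²} T_v Γ(W_κ E_Φ W_κᴴ) T_v⁻¹ = hubbardTorusTT'Twist L t' U n`.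
Route: `Γ(W_κ E_Φ W_κᴴ) = W_G Γ(E_Φ) W_Gᴴ` with the GLOBAL boost `G = χ(n·)` (the embedded window phase
and the boost agree on the window — `fermionEmbed_phaseGauge`, `phaseGauge_conj_eq_of_eqOn`); a torus
translate of the boost is the boost times a constant phase, invisible to the gauge-invariant `Γ(E_Φ)`;
so the sum is `W_G (Σ_v T_v Γ(E_Φ) T_v⁻¹) W_Gᴴ = W_G H^{tt'}_L W_Gᴴ = H^{tt'}_{twist n}` (the tree's
periodisation identity and `conj_hubbardTorusTT'Twist`). [cite: Watanabe2019, §2.2.1]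
[cite: BratteliRobinsonII1997, §6.2.4] -/
theorem sum_relabel_translate_twistedHoppingObs {L : ℕ} [NeZero L] (hL : 3 ≤ L) (t' U : ℝ)
    (κ : Fin 2 → Circle) (n : Fin 2 → ZMod L) (hκ : ∀ i, ZMod.toCircle (n i) = κ i) :
    ∑ v : TorusSite 2 L, relabel (Orb.translate v)
        (fermionEmbed (PolySite.toTorusEmb L (injOn_proj_thicken_one hL)) (twistedHoppingObs t' U κ)) =
      hubbardTorusTT'Twist L t' U n := by
  classical
  set φ := PolySite.toTorusEmb L (injOn_proj_thicken_one (d := 2) hL) with hφ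
  set Y := fermionEmbed φ ((hubbardTTPrimeFermionInteraction 1 t' U).meanEnergyObs 1) with hY
  set G : FermionTorus 2 L → Circle := fun u => boostPhase2 L n u.toTorusSite with hG
  -- the boost restricted to the embedded window is the window twist phase
  have hrange : ∀ y, G (φ y) = windowTwistPhase κ y := fun y => by
    rw [hG, hφ]
    dsimp only
    rw [PolySite.toTorusEmb_apply, FermionTorus.toTorusSite_ofTorusSite, boostPhase2_proj L n κ hκ]
    rfl
  set g' : FermionTorus 2 L → Circle := fun u =>
    if u ∈ (Finset.univ : Finset (PolySite (thicken ({0} : Finset (Site 2)) 1))).map φ then G u else 1 with hg'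
  have hΓW : fermionEmbed φ (phaseGauge (windowTwistPhase κ)) = phaseGauge g' := by
    refine fermionEmbed_phaseGauge φ _ g' (fun y => ?_) (fun u hu => ?_)
    · rw [hg']
      dsimp only
      rw [if_pos (Finset.mem_map_of_mem _ (Finset.mem_univ y)), hrange]
    · rw [hg']
      dsimp only
      rw [if_neg]
      intro hmem
      obtain ⟨y, -, hy⟩ := Finset.mem_map.1 hmem
      exact hu y hy
  have hY0 : HasGaugeCharge 0 Y := (hasGaugeCharge_zero_meanEnergyObs_hubbardTTPrime 1 t' U).fermionEmbed φ
  have hYmem : Y ∈ carSubalgebra (orbs ((Finset.univ : Finset _).map φ)) := fermionEmbed_mem_carSubalgebra φ _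
  -- Step 1: `Γ(W_κ E W_κᴴ) = W_G Y W_Gᴴ`
  have h1 : fermionEmbed φ (twistedHoppingObs t' U κ) = phaseGauge G * Y * (phaseGauge G)ᴴ := by
    rw [twistedHoppingObs, fermionEmbed_mul, fermionEmbed_mul, fermionEmbed_conjTranspose, hΓW]
    exact phaseGauge_conj_eq_of_eqOn g' G (fun u hu => by rw [hg']; dsimp only; rw [if_pos hu]) hYmem
  -- Step 2: translating the boost costs a constant phase, invisible to `T_v Y`
  have h2 : ∀ v : TorusSite 2 L, relabel (Orb.translate v) (phaseGauge G * Y * (phaseGauge G)ᴴ) =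
      phaseGauge G * relabel (Orb.translate v) Y * (phaseGauge G)ᴴ := by
    intro v
    have hsplit : (phaseGauge fun u : FermionTorus 2 L => boostPhase2 L n (u.toTorusSite - v)) =
        phaseGauge G * phaseGauge (fun _ : FermionTorus 2 L => (boostPhase2 L n v)⁻¹) := by
      rw [phaseGauge_mul]
      congr 1
      funext u
      exact boostPhase2_sub L n _ v
    have hconst : relabel (Orb.translate v) (phaseGauge fun _ : FermionTorus 2 L => (boostPhase2 L n v)⁻¹) =
        phaseGauge (fun _ : FermionTorus 2 L => (boostPhase2 L n v)⁻¹) :=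
      relabel_translate_phaseGauge v _
    have hinv : phaseGauge (fun _ : FermionTorus 2 L => (boostPhase2 L n v)⁻¹) * relabel (Orb.translate v) Y *
        (phaseGauge (fun _ : FermionTorus 2 L => (boostPhase2 L n v)⁻¹))ᴴ = relabel (Orb.translate v) Y := by
      rw [← hconst, ← relabel_conjTranspose, ← relabel_mul, ← relabel_mul,
        phaseGauge_const_conj_eq_of_hasGaugeCharge_zero _ hY0]
    rw [relabel_mul, relabel_mul, relabel_conjTranspose, hG, relabel_translate_phaseGauge_toTorusSite, hsplit,
      conjTranspose_mul]
    calc phaseGauge G * phaseGauge (fun _ : FermionTorus 2 L => (boostPhase2 L n v)⁻¹) *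
          relabel (Orb.translate v) Y *
          ((phaseGauge (fun _ : FermionTorus 2 L => (boostPhase2 L n v)⁻¹))ᴴ * (phaseGauge G)ᴴ)
        = phaseGauge G * (phaseGauge (fun _ : FermionTorus 2 L => (boostPhase2 L n v)⁻¹) *
            relabel (Orb.translate v) Y * (phaseGauge (fun _ : FermionTorus 2 L => (boostPhase2 L n v)⁻¹))ᴴ) *
            (phaseGauge G)ᴴ := by simp only [Matrix.mul_assoc]
      _ = phaseGauge G * relabel (Orb.translate v) Y * (phaseGauge G)ᴴ := by rw [hinv]
  -- Step 3: sum, periodise the untwisted density, and gauge back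
  have hW : phaseGauge G * (phaseGauge G)ᴴ = 1 := by
    -- the generic lemma carries the order-derived `DecidableEq` in its `1`; the instances are equal
    have h := phaseGauge_mul_conjTranspose_self G
    convert h
  calc ∑ v : TorusSite 2 L, relabel (Orb.translate v) (fermionEmbed φ (twistedHoppingObs t' U κ))
      = ∑ v : TorusSite 2 L, phaseGauge G * relabel (Orb.translate v) Y * (phaseGauge G)ᴴ := by
        simp_rw [h1, h2]
    _ = phaseGauge G * (∑ v : TorusSite 2 L, relabel (Orb.translate v) Y) * (phaseGauge G)ᴴ := by
        rw [Finset.mul_sum, Finset.sum_mul]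
    _ = phaseGauge G * hubbardTorusTT' L 1 t' U * (phaseGauge G)ᴴ := by
        rw [hY, hφ, sum_relabel_translate_hubbardTTPrime_meanEnergyObs t' 1 U hL]
    _ = phaseGauge G * ((phaseGauge G)ᴴ * hubbardTorusTT'Twist L t' U n * phaseGauge G) * (phaseGauge G)ᴴ := by
        rw [hG, conj_hubbardTorusTT'Twist L hL t' U n]
    _ = hubbardTorusTT'Twist L t' U n := by
        calc phaseGauge G * ((phaseGauge G)ᴴ * hubbardTorusTT'Twist L t' U n * phaseGauge G) * (phaseGauge G)ᴴ
            = (phaseGauge G * (phaseGauge G)ᴴ) * hubbardTorusTT'Twist L t' U n *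
                (phaseGauge G * (phaseGauge G)ᴴ) := by simp only [Matrix.mul_assoc]
          _ = hubbardTorusTT'Twist L t' U n := by rw [hW, Matrix.one_mul, Matrix.mul_one]


/-! ### The sourced flat-twisted density and the T8 object -/

/-- **The local density of the flat-twisted pair-sourced `t–t'` torus**: the sourced energy-density
observable `E^src` with its hopping–interaction part replaced by the twisted one,
`E^src_κ = E^src + Γ(incl)(W_κ E_Φ W_κᴴ − E_Φ) ∈ 𝔄_W` (`W = dWaveSourceWindow`; the `−μn₀` and the
UNTWISTED source `−h(Φ₀ + Φ₀†)` are untouched). One local observable for every torus side: its torus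
translates sum to the T8 object whenever the holonomy is trivial. [cite: Watanabe2019, §2.2.1]
[cite: KomaTasaki1994, §1] -/
def dWaveSourceEnergyObsTT'Twist (t' U μ h : ℝ) (κ : Fin 2 → Circle) : FermionOp dWaveSourceWindow :=
  dWaveSourceEnergyObsTT' t' U μ h +
    fermionEmbed (PolySite.incl thicken_subset_dWaveSourceWindow)
      (twistedHoppingObs t' U κ - (hubbardTTPrimeFermionInteraction 1 t' U).meanEnergyObs 1)

/-- The twisted sourced density is Hermitian. [cite: KomaTasaki1994, §1] -/
theorem dWaveSourceEnergyObsTT'Twist_isHermitian (t' U μ h : ℝ) (κ : Fin 2 → Circle) :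
    (dWaveSourceEnergyObsTT'Twist t' U μ h κ).IsHermitian := by
  unfold dWaveSourceEnergyObsTT'Twist
  refine (dWaveSourceEnergyObsTT'_isHermitian t' U μ h).add ?_
  rw [Matrix.IsHermitian, ← fermionEmbed_conjTranspose,
    ((twistedHoppingObs_isHermitian t' U κ).sub
      (FermionInteraction.meanEnergyObs_isHermitian (hubbardTTPrimeFermionInteraction_isHermitian 1 t' U) 1)).eq]

/-- **PERIODISATION IDENTITY FOR THE T8 OBJECT** (trivial holonomy): for `L ≥ 3` with the window
fitting the torus and a twist `n ∈ (ℤ/L)²` with `χ_L(n_i) = κ_i`,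
`Σ_{v ∈ (ℤ/L)²} T_v Γ(E^src_κ) T_v⁻¹ = dWaveSourceTorusTT'Twist L t' U μ h n` — the flat-twisted
hopping with the UNTWISTED `d`-wave pair source. [cite: Watanabe2019, §2.2.1] [cite: BratteliRobinsonII1997, §6.2.4] -/
theorem sum_relabel_translate_dWaveSourceEnergyObsTT'Twist {L : ℕ} [NeZero L] (hL : 3 ≤ L)
    (hInj : Set.InjOn (Torus.proj (d := 2) L) ↑dWaveSourceWindow) (t' U μ h : ℝ)
    (κ : Fin 2 → Circle) (n : Fin 2 → ZMod L) (hκ : ∀ i, ZMod.toCircle (n i) = κ i) :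
    ∑ v : TorusSite 2 L, relabel (Orb.translate v)
        (fermionEmbed (PolySite.toTorusEmb L hInj) (dWaveSourceEnergyObsTT'Twist t' U μ h κ)) =
      dWaveSourceTorusTT'Twist L t' U μ h n := by
  have hsrc := sum_relabel_translate_dWaveSourceEnergyObsTT' hL hInj t' U μ h
  have htw := sum_relabel_translate_twistedHoppingObs hL t' U κ n hκ
  have hE := sum_relabel_translate_hubbardTTPrime_meanEnergyObs t' 1 U hL
  -- the embedded differences, pulled back through `incl`
  have hincl : ∀ Z : FermionOp (thicken ({0} : Finset (Site 2)) 1),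
      fermionEmbed (PolySite.toTorusEmb L hInj) (fermionEmbed (PolySite.incl thicken_subset_dWaveSourceWindow) Z) =
        fermionEmbed (PolySite.toTorusEmb L (injOn_proj_thicken_one hL)) Z := fun Z =>
    fermionEmbed_toTorusEmb_incl thicken_subset_dWaveSourceWindow hInj Z
  unfold dWaveSourceEnergyObsTT'Twist
  simp only [fermionEmbed_add, fermionEmbed_sub, relabel_add, relabel_sub, Finset.sum_add_distrib, Finset.sum_sub_distrib, hincl,
    hsrc, htw, hE]
  rw [dWaveSourceTorusTT'Twist, dWaveSourceTorusTT']
  abel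


/-! ### The periodised Hamiltonian for EVERY side and the thermodynamic limit -/

open Classical in
/-- **The pair-sourced `t–t'` torus with a UNIFORM `U(1)` twist `κ` per direction, on every side `L`**:
the periodisation `Σ_v T_v Γ(E^src_κ) T_v⁻¹` of the twisted local density (a flat connection with holonomy
`κ_i^L`; junk value `0` on the finitely many sides on which the window does not fit). At trivial holonomy
it IS `dWaveSourceTorusTT'Twist` (`dWaveSourceTorusTT'TwistU1_eq_twist`). [cite: Watanabe2019, §2.2.1] -/
def dWaveSourceTorusTT'TwistU1 (L : ℕ) [NeZero L] (t' U μ h : ℝ) (κ : Fin 2 → Circle) :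
    Matrix (Finset (Orb (FermionTorus 2 L))) (Finset (Orb (FermionTorus 2 L))) ℂ :=
  if hInj : Set.InjOn (Torus.proj (d := 2) L) ↑dWaveSourceWindow then
    ∑ v : TorusSite 2 L, relabel (Orb.translate v)
      (fermionEmbed (PolySite.toTorusEmb L hInj) (dWaveSourceEnergyObsTT'Twist t' U μ h κ))
  else 0

/-- On a side on which the window fits, the twisted torus is the periodisation (definitional).
[cite: BratteliRobinsonII1997, §6.2.4] -/
theorem dWaveSourceTorusTT'TwistU1_eq_sum {L : ℕ} [NeZero L]
    (hInj : Set.InjOn (Torus.proj (d := 2) L) ↑dWaveSourceWindow) (t' U μ h : ℝ) (κ : Fin 2 → Circle) :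
    dWaveSourceTorusTT'TwistU1 L t' U μ h κ =
      ∑ v : TorusSite 2 L, relabel (Orb.translate v)
        (fermionEmbed (PolySite.toTorusEmb L hInj) (dWaveSourceEnergyObsTT'Twist t' U μ h κ)) := by
  rw [dWaveSourceTorusTT'TwistU1, dif_pos hInj]

/-- **Trivial holonomy**: for `L ≥ 3` with the window fitting and `χ_L(n_i) = κ_i`, the uniformly twisted
torus is the T8 object `dWaveSourceTorusTT'Twist L t' U μ h n`. [cite: Watanabe2019, §2.2.1] -/
theorem dWaveSourceTorusTT'TwistU1_eq_twist {L : ℕ} [NeZero L] (hL : 3 ≤ L)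
    (hInj : Set.InjOn (Torus.proj (d := 2) L) ↑dWaveSourceWindow) (t' U μ h : ℝ)
    (κ : Fin 2 → Circle) (n : Fin 2 → ZMod L) (hκ : ∀ i, ZMod.toCircle (n i) = κ i) :
    dWaveSourceTorusTT'TwistU1 L t' U μ h κ = dWaveSourceTorusTT'Twist L t' U μ h n := by
  rw [dWaveSourceTorusTT'TwistU1_eq_sum hInj, sum_relabel_translate_dWaveSourceEnergyObsTT'Twist hL hInj t' U μ h κ n hκ]

/-- **THE THERMODYNAMIC LIMIT OF THE TWISTED SOURCED ENERGY DENSITY EXISTS** (along ALL sides, for every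
uniform twist `κ`): `E₀(dWaveSourceTorusTT'TwistU1 (L+1) t' U μ h κ)/(L+1)² → e(t',U,μ,h;κ)`, the limit being
the minimum of the mean energy `Re ω(E^src_κ)` over translation-invariant infinite-volume states (the tree's
model-free `exists_tendsto_groundEnergy_div_pow`). [cite: BratteliKishimotoRobinson1978, Thm. 2] -/
theorem exists_tendsto_groundEnergy_dWaveSourceTorusTT'TwistU1_div_sq (t' U μ h : ℝ) (κ : Fin 2 → Circle) :
    ∃ e : ℝ, Filter.Tendsto (fun L : ℕ =>
        (dWaveSourceTorusTT'TwistU1 (L + 1) t' U μ h κ).groundEnergy / (((L + 1 : ℕ) : ℝ)) ^ 2)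
        Filter.atTop (nhds e) ∧
      (∀ ω : InfVolFermionState 2, ω.IsTranslationInvariant →
        e ≤ (ω.expect dWaveSourceWindow (dWaveSourceEnergyObsTT'Twist t' U μ h κ)).re) ∧
      ∃ ω : InfVolFermionState 2, ω.IsTranslationInvariant ∧
        (ω.expect dWaveSourceWindow (dWaveSourceEnergyObsTT'Twist t' U μ h κ)).re = e :=
  exists_tendsto_groundEnergy_div_pow (L₀ := 0) (H := fun L => dWaveSourceTorusTT'TwistU1 (L + 1) t' U μ h κ)
    (dWaveSourceEnergyObsTT'Twist_isHermitian t' U μ h κ)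
    (fun _ _ hInj => (dWaveSourceTorusTT'TwistU1_eq_sum hInj t' U μ h κ).symm)

/-! ### Rational twists: trivial holonomy along the sides `L ∈ Nℕ` -/

/-- Holonomy arithmetic: `χ_{Nk}(a k) = χ_N(a)` (`e^{2πi·ak/(Nk)} = e^{2πi·a/N}`, `k ≥ 1`): the twist
`q = 4πa/N` has trivial holonomy exactly on the sides `L ∈ Nℕ`. [cite: Watanabe2019, §2.2.1] -/
theorem toCircle_mul_eq (N k a : ℕ) [NeZero N] [NeZero k] :
    ZMod.toCircle (((a * k : ℕ) : ZMod (N * k))) = ZMod.toCircle ((a : ℕ) : ZMod N) := by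
  apply Subtype.ext
  rw [ZMod.toCircle_natCast, ZMod.toCircle_natCast]
  congr 1
  have hk : ((k : ℕ) : ℂ) ≠ 0 := by exact_mod_cast NeZero.ne k
  have hN : ((N : ℕ) : ℂ) ≠ 0 := by exact_mod_cast NeZero.ne N
  push_cast
  field_simp

/-- **T8 thermodynamic limit along the trivial-holonomy sides.** For a RATIONAL twist `κ_i = χ_N(a_i)`
(`q_i = 4πa_i/N`) the T8 objects `dWaveSourceTorusTT'Twist (Nk) t' U μ h (a·k)` are the uniformly twisted
tori on the sides `L = Nk`, so their energy densities converge (to the all-sides limit `e(κ)`):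
`E₀(dWaveSourceTorusTT'Twist L … n_L)/L² = E₀(dWaveSourceTorusTT'TwistU1 L … κ)/L²` for `L = Nk ≥ max 3 L_inj`.
[cite: Watanabe2019, §2.2.1] [cite: BratteliKishimotoRobinson1978, Thm. 2] -/
theorem dWaveSourceTorusTT'TwistU1_eq_twist_rational (N : ℕ) [NeZero N] (a : Fin 2 → ℕ) (t' U μ h : ℝ) :
    ∃ L₀ : ℕ, ∀ (k : ℕ) [NeZero k], L₀ ≤ N * k →
      dWaveSourceTorusTT'TwistU1 (N * k) t' U μ h (fun i => ZMod.toCircle ((a i : ℕ) : ZMod N)) =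
        dWaveSourceTorusTT'Twist (N * k) t' U μ h (fun i => ((a i * k : ℕ) : ZMod (N * k))) := by
  obtain ⟨L₁, hL₁⟩ := exists_forall_le_injOn_proj (d := 2) dWaveSourceWindow
  refine ⟨max 3 L₁, fun k _ hk => ?_⟩
  haveI : NeZero (N * k) := ⟨mul_ne_zero (NeZero.ne N) (NeZero.ne k)⟩
  exact dWaveSourceTorusTT'TwistU1_eq_twist (le_trans (le_max_left _ _) hk)
    (hL₁ _ (le_trans (le_max_right _ _) hk)) t' U μ h _ _ (fun i => toCircle_mul_eq N k (a i))

end Literature.MathematicalPhysics.QuantumLattice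

end
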